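import Summits.QuantumFields.YangMills.Theorems.LuscherReductionDressedRitzPolyakovLiftTransplantStatics
import Summits.QuantumFields.YangMills.Theorems.LuscherReductionDressedRitzPolyakovLiftTransplantRootR
import HarnessLib

/-!
# Line «polyakovlift» r7 on crux `DressedRitz` (stmt-QuantumFields-20205): (o0) and the separated-basis statics for the r7 predicate `TransplantBasisLR`
# (radius floor `R ≥ Λ^{−1/4}`) — the LR twins asked for by the LEAD (r7 GO, 2026-08-27 20:16Z (iv))

Fleet-service module of seat ym-infvol-p1 g7.  The r7 reshape (`…PolyakovLiftTransplantRootR.lean`) keeps the observables `transplantObsL L Λ R f i` and only re-pins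
the radius: `1 ≤ R`, `1 ≤ R⁴Λ`, `RΛ ≤ 1/4`.  The seat's (o0) engine `liftVec_transplantObsL_pos` (p560815) is predicate-free — it needs `1 ≤ R`, `RΛ ≤ 1/4` and
`3·physLevel(i+2)/2 < R` — so the twins follow by reading the new floor: `R ≥ Λ^{−1/4} > 3E/2` as soon as `(3E/2)⁴·Λ < 1`.

* ★★ `dressedLiftFamily_o0_transplantLR` — (o0) for EVERY `TransplantBasisLR k L Λ g`, every raw vacuum, `β ≥ 1`, whenever `(3·physLevel(k+1)/2)⁴·Λ < 1`;
* ★★ `o0_level_transplantLR` — the (o0) half of the level-`k` text `StaticsForL (TransplantBasisLR k)`: `lam0 = 1/(2((3·physLevel(k+1)/2)⁴ + 1))`, `L0 = 0`;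
* ★★ `staticClauses_transplantLR_of_pairSeparated`, ★★ `staticsForLR_level_of_separated` — both static clauses with `C = 0` for pairwise `PairSeparated` r7 bases.

HONEST FRAMING: bookkeeping on the conditional femto rung R2b1; (o2) for non-separated pairs (RG above the first repeated isotype) untouched; not infinite volume,
not a gap, not Clay.  References: M. Lüscher, NPB 219 (1983) 233 [cite: Luscher1983, §3]; M. Lüscher, U. Wolff, NPB 339 (1990) 222 [cite: LuscherWolff1990].
-/

set_option autoImplicit false

noncomputable section

open MeasureTheory Filter Topology Real
open Literature.MathematicalPhysics.QuantumFieldTheory (GaugeConfig Site gaugeTransform)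
open Literature.Analysis.OperatorTheory.YMMatrixModel
open scoped BigOperators

namespace Summit.QuantumFields.YangMills.Theorems.FemtoTransferGap.PolyakovLift

open Summit.QuantumFields.YangMills.Theorems.FemtoTransferGap

variable {L : ℕ} [NeZero L]

/-- From the r7 floor `1 ≤ R⁴Λ` and `(3E/2)⁴Λ < 1`: `3E/2 < R`. [folklore] -/
theorem radius_gt_of_fourth_floor {R Λ E : ℝ} (hR : 1 ≤ R) (hΛ : 0 < Λ) (hlo : 1 ≤ R ^ 4 * Λ) (hE : (3 / 2 * E) ^ 4 * Λ < 1) : 3 / 2 * E < R := by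
  have hR0 : 0 ≤ R := le_trans zero_le_one hR
  have h1 : (3 / 2 * E) ^ 4 * Λ < R ^ 4 * Λ := lt_of_lt_of_le hE hlo
  have h2 : (3 / 2 * E) ^ 4 < R ^ 4 := lt_of_mul_lt_mul_right h1 hΛ.le
  by_contra h
  have h' : R ≤ 3 / 2 * E := not_lt.1 h
  have : R ^ 4 ≤ (3 / 2 * E) ^ 4 := pow_le_pow_left₀ hR0 h' 4
  linarith

/-- ★★ **Clause (o0) for EVERY r7 basis** (`TransplantBasisLR k L Λ g`), every raw vacuum, every fine lattice, `β ≥ 1`, whenever `(3·physLevel(k+1)/2)⁴·Λ < 1`.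
[cite: Luscher1983, §3] [cite: LuscherWolff1990] -/
theorem dressedLiftFamily_o0_transplantLR {β : ℝ} (hβ : 1 ≤ β) {φ : GaugeConfig 3 L SU2 → ℝ} (hvac : IsRawVacuum β φ)
    {k : ℕ} {Λ : ℝ} (hΛ : 0 < Λ) (hΛk : (3 / 2 * physLevel (k + 1)) ^ 4 * Λ < 1) {g : Fin k → (Cfg → ℝ)} (hbasis : TransplantBasisLR k L Λ g) :
    ∀ i : Fin k, 0 < l2 (dressedLiftFamily β φ g i) (dressedLiftFamily β φ g i) := by
  intro i
  have hgphys : IsPhys (g i) := basisPhysL_transplantBasisLR k L Λ g hbasis i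
  obtain ⟨f, R, hf, hpos, hR1, hlo, hhi, hgi⟩ := hbasis
  have hEi : physLevel ((i : ℕ) + 2) ≤ physLevel (k + 1) := physLevel_mono (by omega) (by omega)
  have hE0 : 0 ≤ physLevel ((i : ℕ) + 2) := physLevel_nonneg (by omega)
  have hEi4 : (3 / 2 * physLevel ((i : ℕ) + 2)) ^ 4 * Λ < 1 := by
    have h1 : (3 / 2 * physLevel ((i : ℕ) + 2)) ^ 4 ≤ (3 / 2 * physLevel (k + 1)) ^ 4 :=
      pow_le_pow_left₀ (by positivity) (by linarith) 4
    nlinarith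
  have hRi : 3 / 2 * physLevel ((i : ℕ) + 2) < R := radius_gt_of_fourth_floor hR1 hΛ hlo hEi4
  have hlift : 0 < l2 (liftVec β φ (g i)) (liftVec β φ (g i)) := by
    rw [hgi i]
    exact liftVec_transplantObsL_pos β hvac hf hpos hR1 hΛ hhi i hRi 0 (flowTime β L)
  exact l2_iterate_self_pos (zero_lt_one.trans_le hβ) (isPhys_liftVec β hvac.1 hgphys) hlift _

/-- ★★ **The (o0) half of the level-`k` text of S-STAT for r7** (`StaticsForL (TransplantBasisLR k)`): `lam0 = 1/(2((3·physLevel(k+1)/2)⁴ + 1))`, `L0 = 0`.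
[cite: Luscher1983, §3] [cite: LuscherWolff1990] -/
theorem o0_level_transplantLR (k : ℕ) : ∃ lam0 : ℝ, 0 < lam0 ∧ ∀ lam : ℝ, 0 < lam → lam ≤ lam0 →
    ∀ (L : ℕ) [NeZero L] (β : ℝ), InFemtoWindow lam β L → ∀ φ : GaugeConfig 3 L SU2 → ℝ, IsRawVacuum β φ →
      ∀ g : Fin k → (Cfg → ℝ), TransplantBasisLR k L (luscherLambda β L) g →
        ∀ i : Fin k, 0 < l2 (dressedLiftFamily β φ g i) (dressedLiftFamily β φ g i) := by
  set A : ℝ := (3 / 2 * physLevel (k + 1)) ^ 4 with hA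
  have hA0 : 0 ≤ A := by positivity
  refine ⟨1 / (2 * (A + 1)), by positivity, fun lam hlam hle L _ β hW φ hvac g hbasis => ?_⟩
  have hΛpos : 0 < luscherLambda β L := lt_of_lt_of_le hlam hW.2.1
  have hΛle : luscherLambda β L ≤ 2 * lam := hW.2.2
  have hΛk : A * luscherLambda β L < 1 := by
    have h1 : A * luscherLambda β L ≤ A * (2 * (1 / (2 * (A + 1)))) := by
      exact mul_le_mul_of_nonneg_left (hΛle.trans (by linarith)) hA0
    have h2 : A * (2 * (1 / (2 * (A + 1)))) = A / (A + 1) := by field_simp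
    have h3 : A / (A + 1) < 1 := by rw [div_lt_one (by positivity)]; linarith
    linarith
  exact dressedLiftFamily_o0_transplantLR hW.1 hvac hΛpos hΛk hbasis

/-- ★★ **Static clauses for a separated r7 basis**: `β ≥ 1`, `(3·physLevel(k+1)/2)⁴·Λ < 1`, any raw vacuum, every `C ≥ 0`. [cite: Luscher1983, §3] [cite: LuscherWolff1990] -/
theorem staticClauses_transplantLR_of_pairSeparated {β : ℝ} (hβ : 1 ≤ β) {φ : GaugeConfig 3 L SU2 → ℝ} (hvac : IsRawVacuum β φ)
    {k : ℕ} {Λ : ℝ} (hΛ : 0 < Λ) (hΛk : (3 / 2 * physLevel (k + 1)) ^ 4 * Λ < 1) {g : Fin k → (Cfg → ℝ)} (hbasis : TransplantBasisLR k L Λ g)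
    (hsep : ∀ i l : Fin k, i ≠ l → PairSeparated (g i) (g l)) {C : ℝ} (hC : 0 ≤ C) :
    StaticClauses k C β (dressedLiftFamily β φ g) :=
  staticClauses_of_pairSeparated_phys β hvac (basisPhysL_transplantBasisLR k L Λ g hbasis)
    (dressedLiftFamily_o0_transplantLR hβ hvac hΛ hΛk hbasis) hsep hC

/-- ★★ **The registered r7 level-`k` statics text restricted to SEPARATED bases, with `C = 0`.** [cite: Luscher1983, §3] [cite: LuscherWolff1990] -/
theorem staticsForLR_level_of_separated (k : ℕ) : ∃ lam0 : ℝ, 0 < lam0 ∧ ∀ lam : ℝ, 0 < lam → lam ≤ lam0 →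
    ∀ (L : ℕ) [NeZero L] (β : ℝ), InFemtoWindow lam β L → ∀ φ : GaugeConfig 3 L SU2 → ℝ, IsRawVacuum β φ →
      ∀ g : Fin k → (Cfg → ℝ), TransplantBasisLR k L (luscherLambda β L) g → (∀ i l : Fin k, i ≠ l → PairSeparated (g i) (g l)) →
        StaticClauses k 0 β (dressedLiftFamily β φ g) := by
  obtain ⟨lam0, hlam0, h⟩ := o0_level_transplantLR k
  refine ⟨lam0, hlam0, fun lam hlam hle L _ β hW φ hvac g hbasis hsep => ?_⟩
  exact staticClauses_of_pairSeparated_phys β hvac (basisPhysL_transplantBasisLR k L _ g hbasis)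
    (h lam hlam hle L β hW φ hvac g hbasis) hsep le_rfl

end Summit.QuantumFields.YangMills.Theorems.FemtoTransferGap.PolyakovLift

end
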